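import Summits.BirchSwinnertonDyer.BirchSwinnertonDyer.Theses.TwistFamilyManinDescent

/-!
# Sketch (g16) — the Ohta divide of the E-facing stub `EtaleExitPS`

`half-twist-raynaud-window`, crux `TwistFamilyManinDescent.EisensteinAdditiveManinResidual`
(stmt-BirchSwinnertonDyer-25138), PS rows only.

g13 typed the line as `HalfTwistOrdinaryTransfer ∧ EtaleExitPS → ResidualPS` (`residualPS_of`).
g14/g15 reduced the E-facing stub `EtaleExitPS` (⟺ DeepOpt(A_g^opt, 𝔭̄) under TWIST-OPT) to
NonSplit ∧ CuspidalAnchor_β, the latter to a Stevens–Vatsal witness + a multiplicity-one step (O2).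

g16: Ohta, *μ-type subgroups of J₁(N) and application to cyclotomic fields*, J. Math. Soc. Japan 72
(2020), Part II Thm (5.1.4)/(5.1.7) [p. 399–400]: for `p` odd, `p ∤ M·φ(M)`, `A ⊋ {1}` a subgroup of
`(ℤ/p)ˣ`, `k_A = k₀·ℚ(ζ_p)^A` (`k₀` abelian, `[k₀:ℚ]` prime to `p`, `p` unramified in `k₀`):
`J₁(Mp; A)` has NO non-trivial μ-type `k_A`-subgroup scheme of `p`-power order.  Applied with
`A = ker ψ_p` (order of `ψ_p` is `e' ∈ {2,3,6} < p − 1` on every PS row) and `k₀ = ℚ(ζ_M)` this kills the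
`G_ℚ`-stable line of character `ω·ψ̃·β⁻¹` (resp. `ω·β⁻¹`) in `A_g^∨[𝔭̄]` (resp. `A_g^∨[𝔭]`), i.e. gives
NonSplit ∧ DeepOpt(A_g^∨, 𝔭̄) ∧ DeepOpt(A_g^∨, 𝔭), hence DeepOpt(A_g^opt, 𝔭̄) (g14 Prop. R transfer) —
with NO cuspidal anchor and NO multiplicity one — on every PS row with `p ∤ φ(M)`, `M = N/p²`.

This file only records the resulting SPLIT of the E-facing stub along the divide `p ∣ φ(N/p²)`:
* `EtaleExitPSCoprime` — the half that "Ohta 2020 + TWIST-OPT" is expected to prove (E-free);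
* `EtaleExitPSTotient` — the honest remainder (`M` has a prime factor `q ≡ 1 (mod p)`; there
  `J₁(Mp;A) ⊇` old Shimura `μ_p`'s and Ohta's conclusion is false as stated; the Vatsal-shaped
  statement "μ-type ⊂ Σ_H" + g14 Remark Σ is the stub);
* the two trivial glue theorems.
Census (kit j332081, N ≤ 5·10⁵, optimal curves): PS Eisenstein rows 1076 = 722 coprime + 354 totient
(p = 13: 12 + 0; p = 7: 282 + 28; p = 5: 428 + 326).
Statements only; the theorems are glue (no `sorry`).  BSD is not proved by this; Manin `c = 1` is not
proved by this; no route item is closed by this.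
-/

open Literature.NumberTheory.EllipticCurves.ModularForms

namespace Summit.BirchSwinnertonDyer.BirchSwinnertonDyer.Cruxes.EisensteinAdditiveManinResidual.HalfTwistRaynaudWindow

/-! ### Copied verbatim from `Cruxes/EisensteinAdditiveManinResidual/HalfTwistOrdinaryPrimeSketch.lean` (g13)
(crux workfiles are checked standalone and are not importable modules); namespace `G16` to avoid clashes. -/
namespace G16

/-- (g13) Principal-series Eisenstein rows: `p = 13`, `(5; III, III*)`, `(7; II, IV, IV*, II*)`. -/
def PSRow (W : WeierstrassCurve ℚ) [W.IsElliptic] [W.IsGloballyMinimal] (p : ℕ) : Prop :=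
  p = 13 ∨ (p = 5 ∧ padicValInt 5 W.minimalDiscriminantInt ∈ ({3, 9} : Finset ℕ)) ∨
    (p = 7 ∧ padicValInt 7 W.minimalDiscriminantInt ∈ ({2, 4, 8, 10} : Finset ℕ))

/-- (g13) Étale exit at `p` for the parametrised curve `W` (lattice `D.L`). -/
def EtaleExitAt (W : WeierstrassCurve ℚ) [W.IsElliptic] (p : ℕ) {N : ℕ} [NeZero N]
    (D : ModularParametrizationData W N) : Prop :=
  ∀ (W' : WeierstrassCurve ℚ) [W'.IsElliptic] [W'.IsGloballyMinimal] (L' : PeriodPair),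
    IsNeronLatticeOf (W'.baseChange ℂ) L' → ∀ μ : ℚ,
      (∀ y ∈ D.L.lattice, (μ : ℂ) * y ∈ L'.lattice) →
      (∃ z ∈ L'.lattice, ∀ y ∈ D.L.lattice, z ≠ (μ : ℂ) * y) →
      (∀ z ∈ L'.lattice, ∃ y ∈ D.L.lattice, (p : ℂ) * z = (μ : ℂ) * y) →
      (∃ y ∈ D.L.lattice, ∀ z ∈ L'.lattice, (μ : ℂ) * y ≠ (p : ℂ) * z) →
      padicValRat p μ = 0

/-- (g13) E-facing stub: on every PS Eisenstein row the `X₀`-optimal curve has étale exit at `p`. -/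
def EtaleExitPS : Prop :=
  ∀ (W : WeierstrassCurve ℚ) [W.IsElliptic] [W.IsGloballyMinimal] {N : ℕ} [NeZero N]
    (D : ModularParametrizationData W N) (p : ℕ) (hp : p.Prime),
    PSRow W p → p ^ 2 ∣ N → ¬ W.HasIrreducibleModPGaloisRep p →
    ¬ ((W.quadraticTwist (((-1 : ℤ) ^ (p / 2) * p : ℤ) : ℚ)).HasGoodReductionAt
          ((Rat.HeightOneSpectrum.primesEquiv (R := ℤ)).symm ⟨p, hp⟩) ∨
        (W.quadraticTwist (((-1 : ℤ) ^ (p / 2) * p : ℤ) : ℚ)).HasMultiplicativeReductionAt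
          ((Rat.HeightOneSpectrum.primesEquiv (R := ℤ)).symm ⟨p, hp⟩)) →
    (∀ z ∈ D.L.lattice, ∃ w ∈ periodLattice D.f, z = D.c * w) →
    EtaleExitAt W p D

/-- (g13) Transfer stub (E-free package at the ordinary prime + TWIST-OPT): étale exit ⇒ `p ∤ c`. -/
def HalfTwistOrdinaryTransfer : Prop :=
  ∀ (W : WeierstrassCurve ℚ) [W.IsElliptic] [W.IsGloballyMinimal] {N : ℕ} [NeZero N]
    (D : ModularParametrizationData W N) (p : ℕ) (hp : p.Prime),
    PSRow W p → p ^ 2 ∣ N → ¬ W.HasIrreducibleModPGaloisRep p →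
    ¬ ((W.quadraticTwist (((-1 : ℤ) ^ (p / 2) * p : ℤ) : ℚ)).HasGoodReductionAt
          ((Rat.HeightOneSpectrum.primesEquiv (R := ℤ)).symm ⟨p, hp⟩) ∨
        (W.quadraticTwist (((-1 : ℤ) ^ (p / 2) * p : ℤ) : ℚ)).HasMultiplicativeReductionAt
          ((Rat.HeightOneSpectrum.primesEquiv (R := ℤ)).symm ⟨p, hp⟩)) →
    (∀ z ∈ D.L.lattice, ∃ w ∈ periodLattice D.f, z = D.c * w) →
    EtaleExitAt W p D →
    ¬ (p : ℤ) ∣ D.maninConstant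

/-- (g13) The residual restricted to the PS rows. -/
def ResidualPS : Prop :=
  ∀ (W : WeierstrassCurve ℚ) [W.IsElliptic] [W.IsGloballyMinimal] {N : ℕ} [NeZero N]
    (D : ModularParametrizationData W N) (p : ℕ) (hp : p.Prime),
    PSRow W p → p ^ 2 ∣ N → ¬ W.HasIrreducibleModPGaloisRep p →
    ¬ ((W.quadraticTwist (((-1 : ℤ) ^ (p / 2) * p : ℤ) : ℚ)).HasGoodReductionAt
          ((Rat.HeightOneSpectrum.primesEquiv (R := ℤ)).symm ⟨p, hp⟩) ∨
        (W.quadraticTwist (((-1 : ℤ) ^ (p / 2) * p : ℤ) : ℚ)).HasMultiplicativeReductionAt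
          ((Rat.HeightOneSpectrum.primesEquiv (R := ℤ)).symm ⟨p, hp⟩)) →
    (∀ z ∈ D.L.lattice, ∃ w ∈ periodLattice D.f, z = D.c * w) →
    ¬ (p : ℤ) ∣ D.maninConstant

/-- (g13) Glue. -/
theorem residualPS_of (h₁ : HalfTwistOrdinaryTransfer) (h₂ : EtaleExitPS) : ResidualPS := by
  intro W _ _ N _ D p hp hrow hsq hred htw hopt
  exact h₁ W D p hp hrow hsq hred htw hopt (h₂ W D p hp hrow hsq hred htw hopt)

/-! ### New in g16: the Ohta divide -/

/-- `EtaleExitPS` restricted to the OHTA side of the divide: `p ∤ φ(N / p²)` (no prime `q ≡ 1 (mod p)`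
divides the tame level `M = N/p²`).  Expected proof: Ohta 2020 Thm (5.1.4) ⇒ no `G_ℚ`-stable μ-type line in
`A_g^∨[𝔭]`, `A_g^∨[𝔭̄]` ⇒ DeepOpt(A_g^opt, 𝔭̄) ⇒ (TWIST-OPT, g13) étale exit of `E_opt` at `p`. -/
def EtaleExitPSCoprime : Prop :=
  ∀ (W : WeierstrassCurve ℚ) [W.IsElliptic] [W.IsGloballyMinimal] {N : ℕ} [NeZero N]
    (D : ModularParametrizationData W N) (p : ℕ) (hp : p.Prime),
    PSRow W p → p ^ 2 ∣ N → ¬ p ∣ Nat.totient (N / p ^ 2) → ¬ W.HasIrreducibleModPGaloisRep p →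
    ¬ ((W.quadraticTwist (((-1 : ℤ) ^ (p / 2) * p : ℤ) : ℚ)).HasGoodReductionAt
          ((Rat.HeightOneSpectrum.primesEquiv (R := ℤ)).symm ⟨p, hp⟩) ∨
        (W.quadraticTwist (((-1 : ℤ) ^ (p / 2) * p : ℤ) : ℚ)).HasMultiplicativeReductionAt
          ((Rat.HeightOneSpectrum.primesEquiv (R := ℤ)).symm ⟨p, hp⟩)) →
    (∀ z ∈ D.L.lattice, ∃ w ∈ periodLattice D.f, z = D.c * w) →
    EtaleExitAt W p D

/-- `EtaleExitPS` on the RESIDUAL side of the divide: `p ∣ φ(N / p²)`, i.e. the tame level has a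
prime factor `q ≡ 1 (mod p)` (326/754 of the `p = 5` rows, 28/310 at `p = 7`, 0/12 at `p = 13`,
N ≤ 5·10⁵).  Stub: the Vatsal-shaped extension of Ohta's theorem on `X_H(pM)` ("every μ-type
`p`-power subgroup lies in the Shimura subgroup Σ_H") + g14 Remark Σ (`Σ_H[p^∞] ∩ A_g^∨ = 0`). -/
def EtaleExitPSTotient : Prop :=
  ∀ (W : WeierstrassCurve ℚ) [W.IsElliptic] [W.IsGloballyMinimal] {N : ℕ} [NeZero N]
    (D : ModularParametrizationData W N) (p : ℕ) (hp : p.Prime),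
    PSRow W p → p ^ 2 ∣ N → p ∣ Nat.totient (N / p ^ 2) → ¬ W.HasIrreducibleModPGaloisRep p →
    ¬ ((W.quadraticTwist (((-1 : ℤ) ^ (p / 2) * p : ℤ) : ℚ)).HasGoodReductionAt
          ((Rat.HeightOneSpectrum.primesEquiv (R := ℤ)).symm ⟨p, hp⟩) ∨
        (W.quadraticTwist (((-1 : ℤ) ^ (p / 2) * p : ℤ) : ℚ)).HasMultiplicativeReductionAt
          ((Rat.HeightOneSpectrum.primesEquiv (R := ℤ)).symm ⟨p, hp⟩)) →
    (∀ z ∈ D.L.lattice, ∃ w ∈ periodLattice D.f, z = D.c * w) →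
    EtaleExitAt W p D

/-- Glue: the two halves of the divide give the E-facing stub of g13. -/
theorem etaleExitPS_of_divide (h₁ : EtaleExitPSCoprime) (h₂ : EtaleExitPSTotient) :
    EtaleExitPS := by
  intro W _ _ N _ D p hp hrow hsq hred htw hopt
  by_cases hφ : p ∣ Nat.totient (N / p ^ 2)
  · exact h₂ W D p hp hrow hsq hφ hred htw hopt
  · exact h₁ W D p hp hrow hsq hφ hred htw hopt

/-- Glue onto the PS-restricted residual: E-free transfer (g13) + Ohta half + residual half. -/
theorem residualPS_of_divide (h₀ : HalfTwistOrdinaryTransfer) (h₁ : EtaleExitPSCoprime)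
    (h₂ : EtaleExitPSTotient) : ResidualPS :=
  residualPS_of h₀ (etaleExitPS_of_divide h₁ h₂)

end G16

end Summit.BirchSwinnertonDyer.BirchSwinnertonDyer.Cruxes.EisensteinAdditiveManinResidual.HalfTwistRaynaudWindow
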